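/-
Copyright (c) 2026. All rights reserved.
Released under Apache 2.0 license as described in the file LICENSE.
-/
import Literature.Probability.FitznerVanDerHofstad2017.NobleBlocksPointwise
import HarnessLib

/-!
# [FvdH17] App. B: the right double non-trivial triangle `B^{(2),ι,a,b}` with the small-triangle letters of rows
`(0,≥2 | d=1)`, `(≥2,≥2 | d=1)`, `(≥2,≥2 | d≥2)` based at the internal vertex `u` — a primed, ADDITIVE copy of
`NobleBlocks.blockBNT₀` / `NobleBlocksPointwise.blockBNTpt₀` (reading D76)

Source: R. Fitzner, R. van der Hofstad, *Mean-field behavior for nearest-neighbor percolation in `d > 10`*,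
Electron. J. Probab. **22** (2017) no. 43 [FvdH17]; extended version arXiv:1506.07977v2, App. B Table "Diagrams
and definition of `B^{(2),ι,a,b}(0,v,x,y)`" (`PercBoundTableBNT`, p. 76, TeX l.10515–10539), its six pictures
(TeX macros `\picBTwoPrimeCase…`, l.6449–6640: the small triangle `u, w, y` with the label "`= 1`" resp. "`≥ 2`" on
the segment `w–u`, "`≥ 1`" on `w–y` and on `y–u`), the row conditions "`d(w,u) = 1` / `≥ 2`" with the factor
`2dD(w−u)`, and the event `F″` of §4.4 (4.58) (p. 41) the table bounds.

THE READING (package DIVERGENCE D76, literature seat gen 17; REFEREE v70 R400: "READING / MISPRINT IN PRINT (family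
D74 (i)); misprint-harmless to every numeral of record; payable only at the typed pointwise level; the typed route
is the primed ADDITIVE module (base `u`); `NobleBlocksNT` is never edited").  Three of the six printed rows base
the small-triangle letter at `y`:
* row `(0,≥2 | d(w,u)=1)`: `2dD(w−u) S_{1,1̲,1,0}(w,u,x,e_ι) T_{1,1,1̲}(u−y,w−y,0)` (l.10516–10519);
* row `(≥2,≥2 | d(u,w)=1)`: `(1/p) 2dD(w−u) T_{1,1,1̲}(u−y,w−y,0) P_{1̲,0,1,1̲,0}(e_ι,x,u,w,v)` (l.10531–10534);
* row `(≥2,≥2 | d(u,w)≥2)`: `B_{1,1}(u−y,w−y) P_{1̲,0,1,2,0}(e_ι,x,u,w,v)` (l.10535–10538);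
whereas the pictures, the conditions `d(w,u)` / the factors `2dD(w−u)`, the three sibling rows (`T_{1,1,1̲}(y−u,
w−u,0)`, `T_{1,1,2}(y−u,w−u,0)`, `T_{2,1,1}(w−u,y−u,0)`) and the lines of `F″` ((4.58): `{x ↔ u}`, `{u ↔ w}` = the
internal line of class `d(u,w)`, `{u ↔ y}`, `{w ↔ y}`; vertices `0 = b̲_i`, `e_ι = b̄_i`, `v = w_i`, `x = w_{i+1}`,
`y = b̲_{i+1}`, `u = t_{i+1}`, `w = z_{i+1}`) base it at `u`: `T_{1,1,1̲}(y−u,w−u,0)` (legs `u → y`, `y → w`,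
`w –1̲→ u`) and `B_{1,1}(y−u,w−u)` (legs `u → y`, `y → w`).  Row `(0,≥2 | d=1)` moreover carries no line for the
pivotal bond `(0,e_ι)`; its repair in the pattern of the five consistent rows (D76 entry, "REPAIR CANDIDATE") is
`(1/p) 2dD(w−u) T_{1,1,1̲}(y−u,w−u,0) P_{1̲,0,1,1̲,1}(e_ι,x,u,w,0)` — the closed pentagon `0 –1̲→ e_ι → x → u –1̲→
w → 0` (pivotal bond, `e_ι → x`, `x → u` of length `≥ 1`, the internal bond, and the exit line `w → 0 = v` of the
level below, of length `≥ 1` since `w ≠ 0`), the internal bond once more as the `1̲` of the small triangle, one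
`1/p`.

THIS MODULE DOES NOT DECIDE BETWEEN THE TWO READINGS and asserts no printed inequality false: it supplies the
base-`u` reading as a PRIMED family — `blockBNT₀'`, `blockBNT'` (general base point), `blockBNTpt₀'`,
`blockBNTpt'` (the internal pair exposed, slot order of the (6.4) chain) — equal to the landed decls in the rows
`a = 1` (`…_one` lemmas) and in the zero arms `b ∈ {0,1}`, differing exactly in the three letters above and in the
first summand of row `a = 0`; with the block-summation identities `tsum_tsum_blockBNTpt₀'`,
`tsum_tsum_blockBNTpt'` (so that `blockBNTpt' L` can be plugged as the parameter `B2pt` of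
`NobleBlocksPointwise.blockBpt` and summed back to `blockB L (blockBNT' L)`), and row read-backs.  Nothing in
`NobleBlocksNT` / `NobleBlocksPointwise` is modified; any `L : Letters d`, any `d`; no numeral; no cited
hypothesis — everything is a definition or a kernel-proved lemma.  (R400 (c): before a NUMERICS consumer covers the
primed rows the engines enter the `Bound[B2i,a,2]` signature line in AGREE; this module is not such a consumer.)

## References
* [FvdH17] arXiv:1506.07977v2 — App. B Table `PercBoundTableBNT` (p. 76) with its pictures; §5.1 Table (p. 47)
  and (5.4) (p. 48); §4.4 (4.58) (p. 41); the sentence after the `B̄^{(2)}` tables (p. 78, l.10592).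
* [Fit13] R. Fitzner, PhD thesis (TU/e 2013), Table 4.21 (p. 202) — the same base-point pattern with "at least"
  indices (genealogy of the reading, D76 entry).
-/

noncomputable section

namespace Literature.Probability.FitznerVanDerHofstad2017.NobleBlocks

open Literature.Probability.LatticeModels Literature.Probability.Percolation
open Literature.Probability.FitznerVanDerHofstad2017.BlockSummation
open scoped BigOperators ENNReal

variable {d : ℕ}

/-! ### A. The primed table `B^{(2),ι,a,b}(0,v,x,y)'` and its translate -/

/-- **`B^{(2),ι,a,b}(0,v,x,y)'`** — the App. B table of `B^{(2)}` (v2 p. 76, TeX l.10515–10539; zero for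
`b = 0,1`, l.10592) with the small-triangle letters of rows `(0,≥2|d=1)`, `(≥2,≥2|d=1)`, `(≥2,≥2|d≥2)` BASED AT `u`
and the first summand of row `a = 0` in the consistent pentagon pattern (reading D76; module docstring):
`a = 0, b ≥ 2 (0 = v ≠ w)`: `d(w,u) = 1`: `(1/p) 2dD(w−u) T_{1,1,1̲}(y−u,w−u,0) P_{1̲,0,1,1̲,1}(e,x,u,w,0)`;
  `d(w,u) ≥ 2`: `S_{1,0,1̲,1}(x−u,e−u,−u,w−u) T_{2,1,1}(w−u,y−u,0)` (verbatim);
`a = 1, b ≥ 2`: both sub-rows verbatim (`blockBNT₀'_one`);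
`a ≥ 2, b ≥ 2`: `d(u,w) = 1`: `(1/p) 2dD(w−u) T_{1,1,1̲}(y−u,w−u,0) P_{1̲,0,1,1̲,0}(e,x,u,w,v)`;
  `d(u,w) ≥ 2`: `B_{1,1}(y−u,w−u) P_{1̲,0,1,2,0}(e,x,u,w,v)`.
[cite: FitznerVanDerHofstad2017, App. B Table "Diagrams and definition of B^{(2),ι,a,b}(0,v,x,y)" with its pictures (arXiv:1506.07977v2 p. 76); §4.4 (4.58) (p. 41)] -/
def blockBNT₀' (L : Letters d) (ι : Fin d × Bool) (a b : Fin 3) (v x y : Site d) : ℝ≥0∞ :=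
  let e : Site d := stepVec ι
  match a.val, b.val with
  | _, 0 => 0
  | _, 1 => 0
  | 0, _ => kd v 0 * ∑' u, ∑' w, kdc v w *
            (L.p⁻¹ * twoDD (w - u) * L.T (.ge 1) (.ge 1) (.eq 1) (y - u) (w - u) 0 *
                L.P (.eq 1) (.ge 0) (.ge 1) (.eq 1) (.ge 1) e x u w 0
              + L.S (.ge 1) (.ge 0) (.eq 1) (.ge 1) (x - u) (e - u) (-u) (w - u) * L.T (.ge 2) (.ge 1) (.ge 1) (w - u) (y - u) 0)
  | 1, _ => ∑' u, ∑' w,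
            (L.p⁻¹ * twoDD v * twoDD (w - u) * L.T (.ge 1) (.ge 1) (.eq 1) (y - u) (w - u) 0 *
                L.P (.eq 1) (.ge 0) (.ge 1) (.eq 1) (.ge 0) e x u w v
              + L.p⁻¹ * L.T (.ge 1) (.ge 1) (.ge 2) (y - u) (w - u) 0 *
                L.P (.ge 1) (.ge 0) (.eq 1) (.eq 1) (.ge 0) (x - u) (e - u) (-u) (v - u) (w - u))
  | _, _ => ∑' u, ∑' w,
            (L.p⁻¹ * twoDD (w - u) * L.T (.ge 1) (.ge 1) (.eq 1) (y - u) (w - u) 0 *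
                L.P (.eq 1) (.ge 0) (.ge 1) (.eq 1) (.ge 0) e x u w v
              + L.B (.ge 1) (.ge 1) (y - u) (w - u) * L.P (.eq 1) (.ge 0) (.ge 1) (.ge 2) (.ge 0) e x u w v)

/-- `B^{(2),ι,a,b}(u,v,x,y)'` (general base point, by translation).
[cite: FitznerVanDerHofstad2017, App. B Table "Diagrams and definition of B^{(2),ι,a,b}(0,v,x,y)" (arXiv:1506.07977v2 p. 76)] -/
def blockBNT' (L : Letters d) : DirBlockFamily d := fun ι a b => ofBase (blockBNT₀' L ι a b)

/-! ### B. The primed table with the internal pair exposed -/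

/-- **The summand of `B^{(2),ι,a,b}(0,v,x,y)'`** as a function of the two internal vertices, printed `(u,w)`, here
`(t,z)`: row by row the expression under `Σ_{u,w}` of `blockBNT₀'`.
[cite: FitznerVanDerHofstad2017, App. B Table "Diagrams and definition of B^{(2),ι,a,b}(0,v,x,y)" with its pictures (arXiv:1506.07977v2 p. 76); §4.4 (4.58) (p. 41)] -/
def blockBNTpt₀' (L : Letters d) (ι : Fin d × Bool) (a b : Fin 3) (v x y t z : Site d) : ℝ≥0∞ :=
  let e : Site d := stepVec ι
  match a.val, b.val with
  | _, 0 => 0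
  | _, 1 => 0
  | 0, _ => kd v 0 * (kdc v z *
            (L.p⁻¹ * twoDD (z - t) * L.T (.ge 1) (.ge 1) (.eq 1) (y - t) (z - t) 0 *
                L.P (.eq 1) (.ge 0) (.ge 1) (.eq 1) (.ge 1) e x t z 0
              + L.S (.ge 1) (.ge 0) (.eq 1) (.ge 1) (x - t) (e - t) (-t) (z - t) *
                L.T (.ge 2) (.ge 1) (.ge 1) (z - t) (y - t) 0))
  | 1, _ => L.p⁻¹ * twoDD v * twoDD (z - t) * L.T (.ge 1) (.ge 1) (.eq 1) (y - t) (z - t) 0 *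
                L.P (.eq 1) (.ge 0) (.ge 1) (.eq 1) (.ge 0) e x t z v
              + L.p⁻¹ * L.T (.ge 1) (.ge 1) (.ge 2) (y - t) (z - t) 0 *
                L.P (.ge 1) (.ge 0) (.eq 1) (.eq 1) (.ge 0) (x - t) (e - t) (-t) (v - t) (z - t)
  | _, _ => L.p⁻¹ * twoDD (z - t) * L.T (.ge 1) (.ge 1) (.eq 1) (y - t) (z - t) 0 *
                L.P (.eq 1) (.ge 0) (.ge 1) (.eq 1) (.ge 0) e x t z v
              + L.B (.ge 1) (.ge 1) (y - t) (z - t) * L.P (.eq 1) (.ge 0) (.ge 1) (.ge 2) (.ge 0) e x t z v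

/-- **Summing the exposed internal pair gives back the primed table entry**:
`Σ_{t,z} blockBNTpt₀' … t z = blockBNT₀' …`.
[cite: FitznerVanDerHofstad2017, App. B Table "Diagrams and definition of B^{(2),ι,a,b}(0,v,x,y)", heading "Σ_{u,w}" (arXiv:1506.07977v2 p. 76)] -/
theorem tsum_tsum_blockBNTpt₀' (L : Letters d) (ι : Fin d × Bool) (a b : Fin 3) (v x y : Site d) :
    ∑' t, ∑' z, blockBNTpt₀' L ι a b v x y t z = blockBNT₀' L ι a b v x y := by
  rcases a with ⟨_ | _ | _ | n, ha⟩ <;> rcases b with ⟨_ | _ | _ | m, hb⟩ <;>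
    first
    | (exfalso; omega)
    | (simp only [blockBNTpt₀', blockBNT₀', tsum_zero, ENNReal.tsum_mul_left])

/-- **The primed `B^{(2)}` pointwise at a general base point, in the chain's slot order**: entry pair `(u,w)`,
internal pair `(t,z)`, exit pair `(w',u')`; `= blockBNTpt₀' L κ a a' (w−u) (w'−u) (u'−u) (t−u) (z−u)` — the shape of
the parameter `B2pt` of `NobleBlocksPointwise.blockBpt`.
[cite: FitznerVanDerHofstad2017, App. B Table "B^{(2),ι,a,b}(0,v,x,y)" (arXiv:1506.07977v2 p. 76); §5.1 (5.4) (p. 48)] -/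
def blockBNTpt' (L : Letters d) (κ : Fin d × Bool) (a a' : Fin 3) (u w t z w' u' : Site d) : ℝ≥0∞ :=
  blockBNTpt₀' L κ a a' (w - u) (w' - u) (u' - u) (t - u) (z - u)

/-- `Σ_{t,z} blockBNTpt' L κ a a' u w t z w' u' = blockBNT' L κ a a' u w w' u'`.
[cite: FitznerVanDerHofstad2017, App. B Table "B^{(2),ι,a,b}(0,v,x,y)", heading "Σ_{u,w}" (arXiv:1506.07977v2 p. 76)] -/
theorem tsum_tsum_blockBNTpt' (L : Letters d) (κ : Fin d × Bool) (a a' : Fin 3) (u w w' u' : Site d) :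
    ∑' t, ∑' z, blockBNTpt' L κ a a' u w t z w' u' = blockBNT' L κ a a' u w w' u' := by
  unfold blockBNTpt'
  have h : ∀ t, ∑' z, blockBNTpt₀' L κ a a' (w - u) (w' - u) (u' - u) (t - u) (z - u)
      = ∑' z, blockBNTpt₀' L κ a a' (w - u) (w' - u) (u' - u) (t - u) z := fun t =>
    tsum_sub_right_eq (fun z => blockBNTpt₀' L κ a a' (w - u) (w' - u) (u' - u) (t - u) z) u
  simp_rw [h]
  rw [tsum_sub_right_eq (fun t => ∑' z, blockBNTpt₀' L κ a a' (w - u) (w' - u) (u' - u) t z) u,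
    tsum_tsum_blockBNTpt₀']
  rfl

/-- The summed primed middle block `B^{κ,a,a'}' := blockB L (blockBNT' L)` is the block summation of the pointwise
(5.4) with the primed parameter: `Σ_{t,z} blockBpt L (blockBNTpt' L) κ a a' u w t z w' u' = blockB L (blockBNT' L) κ a a' u w w' u'`.
[cite: FitznerVanDerHofstad2017, §5.1 (5.4) (arXiv:1506.07977v2 p. 48); App. B (p. 76)] -/
theorem tsum_tsum_blockBpt_blockBNTpt' (L : Letters d) (κ : Fin d × Bool) (a a' : Fin 3) (u w w' u' : Site d) :
    ∑' t, ∑' z, blockBpt L (blockBNTpt' L) κ a a' u w t z w' u' = blockB L (blockBNT' L) κ a a' u w w' u' :=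
  tsum_tsum_blockBpt L (blockBNTpt' L) (blockBNT' L) (tsum_tsum_blockBNTpt' L) κ a a' u w w' u'

/-! ### C. Zero arms, agreement with the landed table, base point, rows -/

section Rows

variable (L : Letters d) (ι : Fin d × Bool)

/-- "for `b = 0,1` we let `B^{(2),ι,a,b}(0,v,x,y) = 0`" — unchanged in the primed table.
[cite: FitznerVanDerHofstad2017, App. B, sentence after the B̄^{(2)} tables (arXiv:1506.07977v2 p. 78)] -/
theorem blockBNT₀'_of_val_le_one (a : Fin 3) {b : Fin 3} (hb : b.val ≤ 1) (v x y : Site d) :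
    blockBNT₀' L ι a b v x y = 0 := by
  unfold blockBNT₀'
  rcases b with ⟨_ | _ | m, hb'⟩
  · rcases a with ⟨_ | _ | _ | n, ha⟩
    · rfl
    · rfl
    · rfl
    · exfalso; omega
  · rcases a with ⟨_ | _ | _ | n, ha⟩
    · rfl
    · rfl
    · rfl
    · exfalso; omega
  · exfalso; change m + 1 + 1 ≤ 1 at hb; omega

/-- The pointwise primed table vanishes for `b = 0,1`.
[cite: FitznerVanDerHofstad2017, App. B, sentence after the B̄^{(2)} tables (arXiv:1506.07977v2 p. 78)] -/
theorem blockBNTpt₀'_of_val_le_one (a : Fin 3) {b : Fin 3} (hb : b.val ≤ 1) (v x y t z : Site d) :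
    blockBNTpt₀' L ι a b v x y t z = 0 := by
  unfold blockBNTpt₀'
  rcases b with ⟨_ | _ | m, hb'⟩
  · rcases a with ⟨_ | _ | _ | n, ha⟩
    · rfl
    · rfl
    · rfl
    · exfalso; omega
  · rcases a with ⟨_ | _ | _ | n, ha⟩
    · rfl
    · rfl
    · rfl
    · exfalso; omega
  · exfalso; change m + 1 + 1 ≤ 1 at hb; omega

/-- Row `a = 1` is verbatim print (already based at `u`): the primed table agrees with `blockBNT₀` there.
[cite: FitznerVanDerHofstad2017, App. B Table "definition of B^{(2),ι,a,b}(0,v,x,y)", rows a = 1 (arXiv:1506.07977v2 p. 76)] -/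
theorem blockBNT₀'_one (b : Fin 3) (v x y : Site d) : blockBNT₀' L ι 1 b v x y = blockBNT₀ L ι 1 b v x y := by
  rcases b with ⟨_ | _ | _ | m, hb⟩ <;> rfl

/-- Row `a = 1` of the pointwise tables agree.
[cite: FitznerVanDerHofstad2017, App. B Table "definition of B^{(2),ι,a,b}(0,v,x,y)", rows a = 1 (arXiv:1506.07977v2 p. 76)] -/
theorem blockBNTpt₀'_one (b : Fin 3) (v x y t z : Site d) :
    blockBNTpt₀' L ι 1 b v x y t z = blockBNTpt₀ L ι 1 b v x y t z := by
  rcases b with ⟨_ | _ | _ | m, hb⟩ <;> rfl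

/-- `B^{(2),ι,1,b}' = B^{(2),ι,1,b}` at every base point.
[cite: FitznerVanDerHofstad2017, App. B Table "definition of B^{(2),ι,a,b}(0,v,x,y)", rows a = 1 (arXiv:1506.07977v2 p. 76)] -/
theorem blockBNT'_one (b : Fin 3) : blockBNT' L ι 1 b = blockBNT L ι 1 b := by
  funext t v x y
  simp only [blockBNT', blockBNT, ofBase, blockBNT₀'_one]

/-- `B^{(2),ι,a,b}(0,v,x,y)'` is the primed table entry.
[cite: FitznerVanDerHofstad2017, App. B Table "definition of B^{(2),ι,a,b}(0,v,x,y)" (arXiv:1506.07977v2 p. 76)] -/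
@[simp] theorem blockBNT'_zero (a b : Fin 3) (v x y : Site d) :
    blockBNT' L ι a b 0 v x y = blockBNT₀' L ι a b v x y := ofBase_zero _ _ _ _

/-- The primed `B^{(2)}` is translation invariant.
[cite: FitznerVanDerHofstad2017, §4.2 "translation invariance" of the two-point events (arXiv:1506.07977v2 p. 35); App. B (p. 76)] -/
theorem isTransInv_blockBNT' (a b : Fin 3) : IsTransInv (blockBNT' L ι a b) := isTransInv_ofBase _

/-- The primed `B^{(2)}` vanishes for `b = 0,1` at every base point.
[cite: FitznerVanDerHofstad2017, App. B, sentence after the B̄^{(2)} tables (arXiv:1506.07977v2 p. 78)] -/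
theorem blockBNT'_of_val_le_one (a : Fin 3) {b : Fin 3} (hb : b.val ≤ 1) (t v x y : Site d) :
    blockBNT' L ι a b t v x y = 0 := by
  simp only [blockBNT', ofBase, blockBNT₀'_of_val_le_one L ι a hb]

/-- The pointwise primed `B^{(2)}` in the chain's slot order vanishes for exit class `a' ∈ {0,1}`.
[cite: FitznerVanDerHofstad2017, App. B, sentence after the B̄^{(2)} tables (arXiv:1506.07977v2 p. 78)] -/
theorem blockBNTpt'_of_val_le_one (κ : Fin d × Bool) (a : Fin 3) {a' : Fin 3} (ha' : a'.val ≤ 1)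
    (u w t z w' u' : Site d) : blockBNTpt' L κ a a' u w t z w' u' = 0 :=
  blockBNTpt₀'_of_val_le_one L κ a ha' _ _ _ _ _

/-- Row `a ≥ 2, b ≥ 2` of the primed table (the two repaired letters `T_{1,1,1̲}(y−u,w−u,0)`, `B_{1,1}(y−u,w−u)`).
[cite: FitznerVanDerHofstad2017, App. B Table "definition of B^{(2),ι,a,b}(0,v,x,y)", last row and its pictures (arXiv:1506.07977v2 p. 76)] -/
theorem blockBNT₀'_two_two (v x y : Site d) :
    blockBNT₀' L ι 2 2 v x y = ∑' u, ∑' w,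
      (L.p⁻¹ * twoDD (w - u) * L.T (.ge 1) (.ge 1) (.eq 1) (y - u) (w - u) 0 *
          L.P (.eq 1) (.ge 0) (.ge 1) (.eq 1) (.ge 0) (stepVec ι) x u w v
        + L.B (.ge 1) (.ge 1) (y - u) (w - u) * L.P (.eq 1) (.ge 0) (.ge 1) (.ge 2) (.ge 0) (stepVec ι) x u w v) := rfl

/-- Row `a = 0, b ≥ 2` of the primed table (first summand repaired, second verbatim).
[cite: FitznerVanDerHofstad2017, App. B Table "definition of B^{(2),ι,a,b}(0,v,x,y)", first row and its pictures (arXiv:1506.07977v2 p. 76)] -/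
theorem blockBNT₀'_zero_two (v x y : Site d) :
    blockBNT₀' L ι 0 2 v x y = kd v 0 * ∑' u, ∑' w, kdc v w *
      (L.p⁻¹ * twoDD (w - u) * L.T (.ge 1) (.ge 1) (.eq 1) (y - u) (w - u) 0 *
          L.P (.eq 1) (.ge 0) (.ge 1) (.eq 1) (.ge 1) (stepVec ι) x u w 0
        + L.S (.ge 1) (.ge 0) (.eq 1) (.ge 1) (x - u) (stepVec ι - u) (-u) (w - u) *
          L.T (.ge 2) (.ge 1) (.ge 1) (w - u) (y - u) 0) := rfl

/-- Row `a ≥ 2, b ≥ 2` of the pointwise primed table.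
[cite: FitznerVanDerHofstad2017, App. B Table "definition of B^{(2),ι,a,b}(0,v,x,y)", last row and its pictures (arXiv:1506.07977v2 p. 76)] -/
theorem blockBNTpt₀'_two_two (v x y t z : Site d) :
    blockBNTpt₀' L ι 2 2 v x y t z =
      L.p⁻¹ * twoDD (z - t) * L.T (.ge 1) (.ge 1) (.eq 1) (y - t) (z - t) 0 *
          L.P (.eq 1) (.ge 0) (.ge 1) (.eq 1) (.ge 0) (stepVec ι) x t z v
        + L.B (.ge 1) (.ge 1) (y - t) (z - t) * L.P (.eq 1) (.ge 0) (.ge 1) (.ge 2) (.ge 0) (stepVec ι) x t z v := rfl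

/-- Row `a = 0, b ≥ 2` of the pointwise primed table.
[cite: FitznerVanDerHofstad2017, App. B Table "definition of B^{(2),ι,a,b}(0,v,x,y)", first row and its pictures (arXiv:1506.07977v2 p. 76)] -/
theorem blockBNTpt₀'_zero_two (v x y t z : Site d) :
    blockBNTpt₀' L ι 0 2 v x y t z = kd v 0 * (kdc v z *
      (L.p⁻¹ * twoDD (z - t) * L.T (.ge 1) (.ge 1) (.eq 1) (y - t) (z - t) 0 *
          L.P (.eq 1) (.ge 0) (.ge 1) (.eq 1) (.ge 1) (stepVec ι) x t z 0
        + L.S (.ge 1) (.ge 0) (.eq 1) (.ge 1) (x - t) (stepVec ι - t) (-t) (z - t) *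
          L.T (.ge 2) (.ge 1) (.ge 1) (z - t) (y - t) 0)) := rfl

/-- Row `a = 0` of the pointwise primed table carries `δ_{v,0}` ("`0 = v`"): it vanishes off `v = 0`.
[cite: FitznerVanDerHofstad2017, App. B Table "definition of B^{(2),ι,a,b}(0,v,x,y)", first row "0 = v ≠ w" (arXiv:1506.07977v2 p. 76)] -/
theorem blockBNTpt₀'_zero_of_ne {v : Site d} (hv : v ≠ 0) (b : Fin 3) (x y t z : Site d) :
    blockBNTpt₀' L ι 0 b v x y t z = 0 := by
  rcases b with ⟨_ | _ | _ | m, hb⟩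
  · rfl
  · rfl
  · show kd v 0 * _ = 0
    rw [kd_of_ne hv, zero_mul]
  · exfalso; omega

end Rows

end Literature.Probability.FitznerVanDerHofstad2017.NobleBlocks

end
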